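import Literature.NumberTheory.EllipticCurves.PAdicDistributionDensity
import Literature.NumberTheory.EllipticCurves.PAdicOneVariableInverseTransformMoments
import Literature.NumberTheory.EllipticCurves.PAdicOneVariableCharacterSupport
import HarnessLib

/-!
# The moments ON THE UNITS of the measure of a power series whose `Ĝ_m`-trace vanishes:
# `∫_{ℤ_p^×} x^{k+1} d(x⁻¹ D_H) = [S^0] D^k H` (de Shalit 1987, I.3.3 (7)–(8) with I.3.5 (11); II.4.7 (17))

De Shalit 1987, I.3.5 (p. 18): "(11) `∫_G κ(σ)^k dμ_β(σ) = D^k log g_β (0)` (`k ≥ 0`)" — where `μ_β`, by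
I.3.3 (7)–(8), is the measure on `ℤ_p` of `ã_β = log̃ g_β ∘ θ`, SUPPORTED ON `ℤ_p^×` because of (7), and
pulled back to `G` by `κ : G ≃ ℤ_p^×` (9)–(10); II.4.7 (17): "`δ̃_k(β) = δ_k(β) − p^{k−1} σ_𝔭(δ_k(β))`".

This file is the SOCKET at which the log-free Coleman output of the tree's units lane
(`LubinTateColemanTraceZero*`: an integral series `h` with `𝒮h = 0`, `H = h ∘ θ`, playing `D log̃ g_β ∘ θ`,
so that `ν = D_H = κμ_β`) meets the Galois-side pull-back `GroupDistribution.comap` of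
`ProfiniteGroupDistributionComap.lean` (which reads the measure `μ_β♭ := restrictUnits (x⁻¹ · ν)` on the unit
classes): under the support hypothesis delivered by `PAdicOneVariableCharacterSupport.lean` /
`PAdicOneVariableTraceCriterion.lean`,

  `∫ x^{k+1} dμ_β♭ = ∫_{ℤ_p} x^k dν = [S^0] D^k H`   (`D = (1+S) d/dS`),

i.e. de Shalit's (11) for `μ_β` in the tree's one-variable currency — the analytic input of the
`𝔭`-unramified range of `DeShalit1987.IsLMeasure` (every moment `k + 1 ≥ 1`; types `(−m, j)`, `m ≥ 1`).

* `BoundedDistribution.integral_unitIndicator_mul_eq_of_forall`: `∫ 𝟙_{ℤ_p^×} f dν = ∫ f dν` when `ν`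
  vanishes on the non-unit classes;
* **`integral_restrictUnits_density_unitInv_pow_succ_eq_constantCoeff`**: the socket identity under the
  support hypothesis; **`…_of_charSum`**: the same under the trace hypothesis
  `∀ n j, Σ_{i<p} H(ζ_n^{j + pⁿ i} − 1) = 0` (`ζ_n` primitive `p^{n+1}`-th roots of unity).

Everything is a theorem; no named facts, no definitions, no instances, no `sorry`.

## References

* [deShalit1987] E. de Shalit, *Iwasawa theory of elliptic curves with complex multiplication* (1987),
  I.3.3 (7)–(10) (p. 17–18), I.3.5 (11) (p. 18), II.4.7 (15)–(17) (p. 60).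
-/

noncomputable section

open Filter Topology Finset
open scoped fwdDiff Classical

namespace Literature.NumberTheory.EllipticCurves

variable {p : ℕ} [Fact p.Prime]
variable {𝕜 : Type*} [NormedField 𝕜] [NormedAlgebra ℚ_[p] 𝕜] [IsUltrametricDist 𝕜] [CompleteSpace 𝕜]

namespace BoundedDistribution

omit [NormedAlgebra ℚ_[p] 𝕜] in
/-- **`∫ 𝟙_{ℤ_p^×} f dν = ∫ f dν` for a distribution vanishing on the non-unit classes** (`𝟙_{ℤ_p^×}(x)` read
as "`x mod p` is a unit"; both `f` and `𝟙 f` uniformly continuous). [cite: deShalit1987, I.3.3 (7′) (p. 17–18)] -/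
theorem integral_unitIndicator_mul_eq_of_forall (ν : BoundedDistribution (ProfiniteTower.padicInt p) 𝕜)
    (hsupp : ∀ (n : ℕ) (b : ZMod (p ^ (n + 1))), ¬ IsUnit b → ν.μ (n + 1) b = 0) {f : ℤ_[p] → 𝕜}
    (hf : UniformContinuous f)
    (hF : UniformContinuous (fun x ↦ (if IsUnit (PadicInt.toZModPow 1 x) then (1 : 𝕜) else 0) * f x)) :
    ν.integral (fun x ↦ (if IsUnit (PadicInt.toZModPow 1 x) then (1 : 𝕜) else 0) * f x) = ν.integral f := by
  rw [← integral_restrictUnits ν hF, ν.integral_restrictUnits_eq_of_forall hsupp hf]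

end BoundedDistribution

variable {H : PowerSeries 𝕜} {C : ℝ}

omit [IsUltrametricDist 𝕜] [CompleteSpace 𝕜] in
/-- `𝟙_{ℤ_p^×} · x^k` (read in `𝕜`) is uniformly continuous on `ℤ_p`. [cite: deShalit1987, I.3.5 (11) (p. 18)] -/
theorem uniformContinuous_unitIndicator_mul_padicIntCast_pow (k : ℕ) :
    UniformContinuous (fun x : ℤ_[p] ↦
      (if IsUnit (PadicInt.toZModPow 1 x) then (1 : 𝕜) else 0) * padicIntCast 𝕜 (x ^ k)) := by
  have hind : UniformContinuous
      (fun x : ℤ_[p] ↦ (if IsUnit (PadicInt.toZModPow 1 x) then (1 : 𝕜) else 0)) :=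
    (ProfiniteTower.padicInt_isUniform p).uniformContinuous_of_proj_eq 1 (fun x y hxy ↦ by
      change PadicInt.toZModPow 1 x = PadicInt.toZModPow 1 y at hxy
      rw [hxy])
  have hind1 : ∀ x : ℤ_[p], ‖(if IsUnit (PadicInt.toZModPow 1 x) then (1 : 𝕜) else 0)‖ ≤ 1 :=
    fun x ↦ by
      split_ifs
      · rw [norm_one]
      · rw [norm_zero]; exact zero_le_one
  exact uniformContinuous_mul_of_norm_le hind (uniformContinuous_padicIntCast_pow k) hind1
    (fun x ↦ norm_padicIntCast_le_one _)

/-- **THE SOCKET IDENTITY (de Shalit's (11) for `μ_β` through the log-free series): if the measure `D_H`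
of `H` is supported on `ℤ_p^×`, then `∫ x^{k+1} d(restrictUnits (x⁻¹ · D_H)) = [S^0] D^k H`** — the
`(k+1)`-st moment of `μ_β♭ = (x⁻¹ · D_H)|_{ℤ_p^×}` is the constant term of `((1+S) d/dS)^k H`
(`= D^{k+1} log̃ g_β ∘ θ (0) = δ̃_{k+1}(β)` for `H = D log̃ g_β ∘ θ`).
[cite: deShalit1987, I.3.5 (11) (p. 18), I.3.3 (7)–(8) (p. 17), II.4.7 (17) (p. 60)] -/
theorem integral_restrictUnits_density_unitInv_pow_succ_eq_constantCoeff
    (hC : ∀ m, ‖PowerSeries.coeff m H‖ ≤ C)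
    (hsupp : ∀ (n : ℕ) (b : ZMod (p ^ (n + 1))), ¬ IsUnit b → (invAmice₁ p H hC).μ (n + 1) b = 0)
    (k : ℕ) :
    (restrictUnits ((invAmice₁ p H hC).density (ProfiniteTower.padicInt_isUniform p) (unitInv 𝕜)
        uniformContinuous_unitInv norm_unitInv_le)).integral (fun x ↦ padicIntCast 𝕜 (x ^ (k + 1))) =
      PowerSeries.constantCoeff (mahlerD^[k] H) := by
  rw [integral_restrictUnits_density_unitInv_pow_succ,
    (invAmice₁ p H hC).integral_unitIndicator_mul_eq_of_forall hsupp (uniformContinuous_padicIntCast_pow k)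
      (uniformContinuous_unitIndicator_mul_padicIntCast_pow k),
    integral_invAmice₁_pow_eq_constantCoeff]

/-- **The socket identity under the TRACE hypothesis** (de Shalit I.3.3 (7) ⟹ (7′) ⟹ (11)): if for a system of
primitive `p^{n+1}`-th roots of unity `ζ n` the `Ĝ_m`-traces `Σ_{i<p} H(ζ_n^{j + pⁿ i} − 1)` vanish for all
`n, j`, then `∫ x^{k+1} d(restrictUnits (x⁻¹ · D_H)) = [S^0] D^k H` for every `k`.
[cite: deShalit1987, I.3.3 (7)–(8) (p. 17), I.3.5 (11) (p. 18)] -/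
theorem integral_restrictUnits_density_unitInv_pow_succ_eq_constantCoeff_of_charSum
    (hC : ∀ m, ‖PowerSeries.coeff m H‖ ≤ C) (ζ : ℕ → 𝕜)
    (hζ : ∀ n, IsPrimitiveRoot (ζ n) (p ^ (n + 1)))
    (htrace : ∀ n j : ℕ,
      ∑ i ∈ range p, ∑' m : ℕ, PowerSeries.coeff m H * (ζ n ^ (j + p ^ n * i) - 1) ^ m = 0) (k : ℕ) :
    (restrictUnits ((invAmice₁ p H hC).density (ProfiniteTower.padicInt_isUniform p) (unitInv 𝕜)
        uniformContinuous_unitInv norm_unitInv_le)).integral (fun x ↦ padicIntCast 𝕜 (x ^ (k + 1))) =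
      PowerSeries.constantCoeff (mahlerD^[k] H) :=
  integral_restrictUnits_density_unitInv_pow_succ_eq_constantCoeff hC
    (fun n ↦ (forall_invAmice₁_μ_eq_zero_iff hC n (hζ n)).mpr (htrace n)) k

/-- **The full moments of `D_H` on the units**: under the support hypothesis,
`∫ 𝟙_{ℤ_p^×}(x) x^k dD_H(x) = [S^0] D^k H` for every `k` (the right side of the moment shift
`integral_restrictUnits_density_unitInv_pow_succ`). [cite: deShalit1987, I.3.5 (11) (p. 18)] -/
theorem integral_unitIndicator_mul_pow_invAmice₁_eq_constantCoeff
    (hC : ∀ m, ‖PowerSeries.coeff m H‖ ≤ C)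
    (hsupp : ∀ (n : ℕ) (b : ZMod (p ^ (n + 1))), ¬ IsUnit b → (invAmice₁ p H hC).μ (n + 1) b = 0)
    (k : ℕ) :
    (invAmice₁ p H hC).integral (fun x ↦
        (if IsUnit (PadicInt.toZModPow 1 x) then (1 : 𝕜) else 0) * padicIntCast 𝕜 (x ^ k)) =
      PowerSeries.constantCoeff (mahlerD^[k] H) := by
  rw [(invAmice₁ p H hC).integral_unitIndicator_mul_eq_of_forall hsupp (uniformContinuous_padicIntCast_pow k)
      (uniformContinuous_unitIndicator_mul_padicIntCast_pow k),
    integral_invAmice₁_pow_eq_constantCoeff]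

end Literature.NumberTheory.EllipticCurves

end
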